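import Mathlib.Analysis.Complex.LocallyUniformLimit
import Mathlib.Analysis.SpecialFunctions.Complex.LogBounds
import Mathlib.Analysis.SpecialFunctions.Complex.LogDeriv
import Mathlib.Analysis.SpecialFunctions.Pow.Deriv
import Literature.NumberTheory.LFunctions.RayClassLogEuler
import Literature.NumberTheory.LFunctions.AbelianFrobeniusDensity
import HarnessLib

/-!
# The logarithmic derivative of an Euler product over the primes of a number field

Topic `Literature/NumberTheory/LFunctions`; namespace `Literature.NumberTheory.LFunctions.EulerLogDeriv`.
Pure-proof file (theorems only: no definition, no named fact).  It is the complex-variable companion of the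
real-variable `logEuler` calculus of `AbelianFrobeniusDensity.lean` / `RayClassLogEuler.lean` (which work at
real `s > 1`, enough for Dirichlet densities), needed for NATURAL densities (Wiener–Ikehara wants the
Dirichlet series on the open half-plane `Re s > 1` and a continuous extension to `Re s ≥ 1`).

Let `K` be a number field, `v` run over the non-zero primes of `𝓞 K`, `N v = Ideal.absNorm v.asIdeal ≥ 2`,
and `c : v ↦ c_v ∈ ℂ` with `‖c_v‖ ≤ 1` (e.g. the values of a ray class character, or `c = 1`).  Write
`z_v(s) = c_v N v^{-s}` and consider, for complex `s`,

* the prime Dirichlet series `P(s) = Σ_v c_v N v^{-s}` and its weighted form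
  `D(s) = Σ_v c_v log(N v) N v^{-s}` (absolutely convergent for `Re s > 1`);
* the remainder `R(s) = Σ_v (−log(1 − z_v(s)) − z_v(s))` (absolutely and locally uniformly convergent for
  `Re s > 1/2`, hence holomorphic there);
* the Euler product `L(s) = ∏_v (1 − z_v(s))⁻¹ = exp(P(s) + R(s))` (`Re s > 1`).

Results (all proved):

* `hasDerivAt_tsum_primeTerm` — `P` is holomorphic on `Re s > 1` with `P'(s) = −D(s)` (termwise
  differentiation, Mathlib `Complex.hasSum_deriv_of_summable_norm`);
* `differentiableOn_tsum_remTerm` — `R` is holomorphic on `Re s > 1/2`;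
* `hasProd_cexp_tsum` — `∏_v (1 − z_v(s))⁻¹ = exp(P(s) + R(s))` for `Re s > 1` (Mathlib `HasSum.cexp`);
* **`exists_continuousOn_eq_tsum_logTerm_sub`** — the form consumed by Tauberian arguments: if `G` is
  holomorphic on an open set `U ⊇ {Re s ≥ 1}`, non-vanishing on `{Re s ≥ 1}`, and
  `G(s) = (s − 1)^k · L(s)` on `Re s > 1` for some `k ∈ ℕ` and some function `L` with
  `∏_v (1 − z_v(s))⁻¹ = L(s)` there, then `s ↦ D(s) − k/(s − 1)` extends continuously to `{Re s ≥ 1}`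
  (namely by `−G'/G + R'`).  With `k = 1`, `c = 1`, `G = (s − 1)ζ_K(s)` (Landau) this is
  "`Σ_𝔭 log N𝔭 · N𝔭^{-s} − 1/(s−1)` is regular on `Re s ≥ 1`"; with `k = 0` and `c` a non-principal ray
  class character (Hecke's entire continuation, Landau's `L(1+it, χ) ≠ 0`) it is the regularity of
  `Σ_𝔭 χ(𝔭) log N𝔭 · N𝔭^{-s}` on `Re s ≥ 1` — the two analytic inputs of the prime ideal theorem for ray
  classes / Chebotarev's theorem in natural-density form (Landau 1918; Montgomery–Vaughan §8.3–8.4 for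
  `K = ℚ`).

This is the standard passage "`−L'/L(s) = Σ_𝔭 Σ_m χ(𝔭)^m log N𝔭 · N𝔭^{-ms}`, and the terms with `m ≥ 2`
are regular for `Re s > 1/2`" (Neukirch VII §8 p. 494 and §13 p. 543 for `log L`; Montgomery–Vaughan
Thm. 8.9 / p. 267 for `ζ_K`), organised so that prime powers never appear: only the prime part `D` is a
Dirichlet series, the rest is absorbed in the holomorphic `R`.

## References

* J. Neukirch, *Algebraic Number Theory*, Springer 1999, Ch. VII §8 (8.1) and p. 494, §13 p. 543.
  [NeukirchANT1999]
* H. L. Montgomery, R. C. Vaughan, *Multiplicative Number Theory I*, CUP 2007, §8.3 (Cor. 8.8) and §8.4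
  (Thm. 8.9, p. 267). [MontgomeryVaughan2007]
* E. Landau, *Über Ideale und Primideale in Idealklassen*, Math. Z. 2 (1918), 52–154.

## Mathlib / tree search

Tree: `summable_absNorm_rpow_neg`, `absNorm_heightOneSpectrum_pos`, `absNorm_rpow_neg_le_rpow_neg`
(`RayClassLogEuler`); `AbelianDensity.two_le_absNorm` and the real-variable `AbelianDensity.logEuler`,
`hasProd_cexp_logEuler` (`AbelianFrobeniusDensity`).  Mathlib:
`Complex.differentiableOn_tsum_of_summable_norm`, `Complex.hasSum_deriv_of_summable_norm`, `HasSum.cexp`,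
`Complex.norm_log_one_add_sub_self_le`, `HasDerivAt.const_cpow`, `Complex.norm_natCast_cpow_of_pos`.
`lean search 'logDeriv.*Euler|Euler.*logDeriv|tsum_primeTerm'`: no prior complex-variable version in the tree.
-/

noncomputable section

open Complex Filter NumberField IsDedekindDomain

open scoped _root_.Topology

namespace Literature.NumberTheory.LFunctions

namespace EulerLogDeriv

variable {K : Type*} [Field K] [NumberField K]

/-! ### Elementary estimates on `N v ^ (-s)` -/

/-- `N v ≥ 2` as real numbers (the tree's `AbelianDensity.two_le_absNorm`, cast). [folklore] -/
theorem two_le_absNorm_real (v : HeightOneSpectrum (𝓞 K)) :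
    (2 : ℝ) ≤ ((Ideal.absNorm v.asIdeal : ℕ) : ℝ) := by
  exact_mod_cast AbelianDensity.two_le_absNorm K v

/-- `‖N v ^ (-s)‖ = N v ^ (-Re s)`. [folklore] -/
theorem norm_absNorm_cpow_neg (v : HeightOneSpectrum (𝓞 K)) (s : ℂ) :
    ‖((Ideal.absNorm v.asIdeal : ℕ) : ℂ) ^ (-s)‖ = ((Ideal.absNorm v.asIdeal : ℕ) : ℝ) ^ (-s.re) := by
  rw [Complex.norm_natCast_cpow_of_pos (absNorm_heightOneSpectrum_pos v), Complex.neg_re]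

/-- `N v ^ (-a) ≤ 2 ^ (-a)` for `a ≥ 0`. [folklore] -/
theorem absNorm_rpow_neg_le_two_rpow (v : HeightOneSpectrum (𝓞 K)) {a : ℝ} (ha : 0 ≤ a) :
    ((Ideal.absNorm v.asIdeal : ℕ) : ℝ) ^ (-a) ≤ (2 : ℝ) ^ (-a) :=
  Real.rpow_le_rpow_of_nonpos (by norm_num) (two_le_absNorm_real v) (by linarith)

/-- `2 ^ (-a) < 1` for `a > 0`. [folklore] -/
theorem two_rpow_neg_lt_one {a : ℝ} (ha : 0 < a) : (2 : ℝ) ^ (-a) < 1 :=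
  Real.rpow_lt_one_of_one_lt_of_neg (by norm_num) (by linarith)

variable {c : HeightOneSpectrum (𝓞 K) → ℂ}

/-- `‖c_v N v^{-s}‖ ≤ N v ^ (-Re s)` when `‖c_v‖ ≤ 1`. [folklore] -/
theorem norm_primeTerm_le (hc : ∀ v, ‖c v‖ ≤ 1) (v : HeightOneSpectrum (𝓞 K)) (s : ℂ) :
    ‖c v * ((Ideal.absNorm v.asIdeal : ℕ) : ℂ) ^ (-s)‖ ≤ ((Ideal.absNorm v.asIdeal : ℕ) : ℝ) ^ (-s.re) := by
  rw [norm_mul, ← norm_absNorm_cpow_neg v s]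
  exact mul_le_of_le_one_left (norm_nonneg _) (hc v)

/-! ### Summability -/

/-- `Σ_v log(N v) · N v^{-a}` converges for `a > 1` (compare with `Σ_v N v^{-(a+1)/2}` through
`log x ≤ x^ε/ε`). [folklore] -/
theorem summable_log_mul_absNorm_rpow_neg {a : ℝ} (ha : 1 < a) :
    Summable fun v : HeightOneSpectrum (𝓞 K) =>
      Real.log ((Ideal.absNorm v.asIdeal : ℕ) : ℝ) * ((Ideal.absNorm v.asIdeal : ℕ) : ℝ) ^ (-a) := by
  set ε : ℝ := (a - 1) / 2 with hε
  have hε0 : 0 < ε := by rw [hε]; linarith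
  have hsum := (summable_absNorm_rpow_neg (K := K) (s := (a + 1) / 2) (by linarith)).mul_left (1 / ε)
  refine Summable.of_nonneg_of_le (fun v => ?_) (fun v => ?_) hsum
  · exact mul_nonneg (Real.log_nonneg (by linarith [two_le_absNorm_real v])) (Real.rpow_nonneg (by positivity) _)
  · have hx : (0 : ℝ) ≤ ((Ideal.absNorm v.asIdeal : ℕ) : ℝ) := by positivity
    have hlog := Real.log_le_rpow_div hx hε0
    have hpos : 0 < ((Ideal.absNorm v.asIdeal : ℕ) : ℝ) := by linarith [two_le_absNorm_real v]
    calc Real.log ((Ideal.absNorm v.asIdeal : ℕ) : ℝ) * ((Ideal.absNorm v.asIdeal : ℕ) : ℝ) ^ (-a)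
        ≤ ((Ideal.absNorm v.asIdeal : ℕ) : ℝ) ^ ε / ε * ((Ideal.absNorm v.asIdeal : ℕ) : ℝ) ^ (-a) :=
          mul_le_mul_of_nonneg_right hlog (Real.rpow_nonneg hx _)
      _ = 1 / ε * (((Ideal.absNorm v.asIdeal : ℕ) : ℝ) ^ ε * ((Ideal.absNorm v.asIdeal : ℕ) : ℝ) ^ (-a)) := by
          ring
      _ = 1 / ε * ((Ideal.absNorm v.asIdeal : ℕ) : ℝ) ^ (-((a + 1) / 2)) := by
          rw [← Real.rpow_add hpos, show ε + -a = -((a + 1) / 2) by rw [hε]; ring]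

/-- The prime series `Σ_v c_v N v^{-s}` converges absolutely for `Re s > 1`. [folklore] -/
theorem summable_norm_primeTerm (hc : ∀ v, ‖c v‖ ≤ 1) {s : ℂ} (hs : 1 < s.re) :
    Summable fun v : HeightOneSpectrum (𝓞 K) => ‖c v * ((Ideal.absNorm v.asIdeal : ℕ) : ℂ) ^ (-s)‖ :=
  Summable.of_nonneg_of_le (fun _ => norm_nonneg _) (fun v => norm_primeTerm_le hc v s)
    (summable_absNorm_rpow_neg hs)

/-- The weighted prime series `Σ_v c_v log(N v) N v^{-s}` converges absolutely for `Re s > 1`. [folklore] -/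
theorem summable_norm_logTerm (hc : ∀ v, ‖c v‖ ≤ 1) {s : ℂ} (hs : 1 < s.re) :
    Summable fun v : HeightOneSpectrum (𝓞 K) =>
      ‖c v * (Real.log ((Ideal.absNorm v.asIdeal : ℕ) : ℝ) : ℂ) * ((Ideal.absNorm v.asIdeal : ℕ) : ℂ) ^ (-s)‖ := by
  refine Summable.of_nonneg_of_le (fun _ => norm_nonneg _) (fun v => ?_) (summable_log_mul_absNorm_rpow_neg hs)
  rw [norm_mul, norm_mul, Complex.norm_real, Real.norm_eq_abs,
    abs_of_nonneg (Real.log_nonneg (by linarith [two_le_absNorm_real v])), norm_absNorm_cpow_neg]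
  have h1 : ‖c v‖ * Real.log ((Ideal.absNorm v.asIdeal : ℕ) : ℝ) ≤ Real.log ((Ideal.absNorm v.asIdeal : ℕ) : ℝ) :=
    mul_le_of_le_one_left (Real.log_nonneg (by linarith [two_le_absNorm_real v])) (hc v)
  exact mul_le_mul_of_nonneg_right h1 (Real.rpow_nonneg (by positivity) _)

/-! ### The prime series `P(s) = Σ_v c_v N v^{-s}` and its derivative -/

/-- `d/ds (c_v N v^{-s}) = −c_v log(N v) N v^{-s}`. [folklore] -/
theorem hasDerivAt_primeTerm (v : HeightOneSpectrum (𝓞 K)) (s : ℂ) :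
    HasDerivAt (fun w : ℂ => c v * ((Ideal.absNorm v.asIdeal : ℕ) : ℂ) ^ (-w))
      (-(c v * (Real.log ((Ideal.absNorm v.asIdeal : ℕ) : ℝ) : ℂ) * ((Ideal.absNorm v.asIdeal : ℕ) : ℂ) ^ (-s))) s := by
  have hn0 : ((Ideal.absNorm v.asIdeal : ℕ) : ℂ) ≠ 0 := by
    exact_mod_cast (absNorm_heightOneSpectrum_pos v).ne'
  have h1 := (hasDerivAt_neg' s).const_cpow (c := ((Ideal.absNorm v.asIdeal : ℕ) : ℂ)) (Or.inl hn0)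
  have h2 := h1.const_mul (c v)
  refine h2.congr_deriv ?_
  rw [Complex.natCast_log]
  ring

/-- **`P'(s) = −D(s)` for `Re s > 1`**: the prime series is holomorphic on `Re s > 1` and its derivative is
`−Σ_v c_v log(N v) N v^{-s}`, the series converging (termwise differentiation under a summable majorant on
`Re s > 1 + δ`). [folklore] -/
theorem hasDerivAt_tsum_primeTerm (hc : ∀ v, ‖c v‖ ≤ 1) {s : ℂ} (hs : 1 < s.re) :
    HasDerivAt (fun w : ℂ => ∑' v : HeightOneSpectrum (𝓞 K), c v * ((Ideal.absNorm v.asIdeal : ℕ) : ℂ) ^ (-w))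
      (-∑' v : HeightOneSpectrum (𝓞 K),
        c v * (Real.log ((Ideal.absNorm v.asIdeal : ℕ) : ℝ) : ℂ) * ((Ideal.absNorm v.asIdeal : ℕ) : ℂ) ^ (-s)) s := by
  -- work on the half-plane `Re w > a`, `1 < a < Re s`
  obtain ⟨a, ha1, has⟩ := exists_between hs
  set U : Set ℂ := {w | a < w.re} with hU
  have hUo : IsOpen U := isOpen_lt continuous_const Complex.continuous_re
  have hsU : s ∈ U := has
  have hF : ∀ v : HeightOneSpectrum (𝓞 K), DifferentiableOn ℂ
      (fun w : ℂ => c v * ((Ideal.absNorm v.asIdeal : ℕ) : ℂ) ^ (-w)) U :=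
    fun v w _ => (hasDerivAt_primeTerm v w).differentiableAt.differentiableWithinAt
  have hle : ∀ (v : HeightOneSpectrum (𝓞 K)) (w : ℂ), w ∈ U →
      ‖c v * ((Ideal.absNorm v.asIdeal : ℕ) : ℂ) ^ (-w)‖ ≤ ((Ideal.absNorm v.asIdeal : ℕ) : ℝ) ^ (-a) :=
    fun v w hw => (norm_primeTerm_le hc v w).trans (absNorm_rpow_neg_le_rpow_neg v (le_of_lt hw))
  have hsum := Complex.hasSum_deriv_of_summable_norm (summable_absNorm_rpow_neg ha1) hF hUo hle hsU
  have hdiff := (Complex.differentiableOn_tsum_of_summable_norm (summable_absNorm_rpow_neg ha1) hF hUo hle)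
  have hderiv : ∀ v : HeightOneSpectrum (𝓞 K),
      deriv (fun w : ℂ => c v * ((Ideal.absNorm v.asIdeal : ℕ) : ℂ) ^ (-w)) s =
        -(c v * (Real.log ((Ideal.absNorm v.asIdeal : ℕ) : ℝ) : ℂ) * ((Ideal.absNorm v.asIdeal : ℕ) : ℂ) ^ (-s)) :=
    fun v => (hasDerivAt_primeTerm v s).deriv
  simp only [hderiv] at hsum
  have hval : deriv (fun w : ℂ => ∑' v : HeightOneSpectrum (𝓞 K),
      c v * ((Ideal.absNorm v.asIdeal : ℕ) : ℂ) ^ (-w)) s =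
      -∑' v : HeightOneSpectrum (𝓞 K),
        c v * (Real.log ((Ideal.absNorm v.asIdeal : ℕ) : ℝ) : ℂ) * ((Ideal.absNorm v.asIdeal : ℕ) : ℂ) ^ (-s) := by
    rw [hsum.tsum_eq.symm, tsum_neg]
  rw [← hval]
  exact ((hdiff s hsU).differentiableAt (hUo.mem_nhds hsU)).hasDerivAt

/-- The prime series is holomorphic on `Re s > 1`. [folklore] -/
theorem differentiableOn_tsum_primeTerm (hc : ∀ v, ‖c v‖ ≤ 1) :
    DifferentiableOn ℂ (fun w : ℂ => ∑' v : HeightOneSpectrum (𝓞 K),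
      c v * ((Ideal.absNorm v.asIdeal : ℕ) : ℂ) ^ (-w)) {s | 1 < s.re} :=
  fun _ hs => (hasDerivAt_tsum_primeTerm hc hs).differentiableAt.differentiableWithinAt

/-! ### The remainder `R(s) = Σ_v (−log(1 − z_v) − z_v)`, holomorphic on `Re s > 1/2` -/

/-- For `‖z‖ ≤ θ < 1`: `‖−log(1 − z) − z‖ ≤ (1 − θ)⁻¹/2 · ‖z‖²` (Mathlib
`Complex.norm_log_one_add_sub_self_le`). [folklore] -/
theorem norm_neg_log_one_sub_sub_le {θ : ℝ} (hθ : θ < 1) {z : ℂ} (hz : ‖z‖ ≤ θ) :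
    ‖-Complex.log (1 - z) - z‖ ≤ (1 - θ)⁻¹ / 2 * ‖z‖ ^ 2 := by
  have h1 : ‖-z‖ < 1 := by rw [norm_neg]; linarith
  have h := Complex.norm_log_one_add_sub_self_le h1
  rw [norm_neg, ← sub_eq_add_neg, sub_neg_eq_add] at h
  rw [show -Complex.log (1 - z) - z = -(Complex.log (1 - z) + z) by ring, norm_neg]
  refine h.trans ?_
  have h3 : (1 - ‖z‖)⁻¹ ≤ (1 - θ)⁻¹ := by
    rw [inv_le_inv₀ (by linarith) (by linarith)]
    linarith
  have h4 : 0 ≤ ‖z‖ ^ 2 := sq_nonneg _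
  calc ‖z‖ ^ 2 * (1 - ‖z‖)⁻¹ / 2 ≤ ‖z‖ ^ 2 * (1 - θ)⁻¹ / 2 := by gcongr
    _ = (1 - θ)⁻¹ / 2 * ‖z‖ ^ 2 := by ring

/-- On `Re s > b > 0`: `‖z_v(s)‖ ≤ N v^{-b} ≤ 2^{-b} < 1`. [folklore] -/
theorem norm_primeTerm_le_two_rpow (hc : ∀ v, ‖c v‖ ≤ 1) {b : ℝ} (hb : 0 < b) (v : HeightOneSpectrum (𝓞 K))
    {s : ℂ} (hs : b < s.re) :
    ‖c v * ((Ideal.absNorm v.asIdeal : ℕ) : ℂ) ^ (-s)‖ ≤ (2 : ℝ) ^ (-b) :=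
  ((norm_primeTerm_le hc v s).trans (absNorm_rpow_neg_le_rpow_neg v hs.le)).trans
    (absNorm_rpow_neg_le_two_rpow v hb.le)

/-- Each remainder term `−log(1 − z_v(s)) − z_v(s)` is holomorphic on `Re s > 0` (`1 − z_v(s)` lies in the
slit plane since `‖z_v(s)‖ < 1`). [folklore] -/
theorem differentiableAt_remTerm (hc : ∀ v, ‖c v‖ ≤ 1) (v : HeightOneSpectrum (𝓞 K)) {s : ℂ} (hs : 0 < s.re) :
    DifferentiableAt ℂ (fun w : ℂ => -Complex.log (1 - c v * ((Ideal.absNorm v.asIdeal : ℕ) : ℂ) ^ (-w)) -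
      c v * ((Ideal.absNorm v.asIdeal : ℕ) : ℂ) ^ (-w)) s := by
  have hz : DifferentiableAt ℂ (fun w : ℂ => c v * ((Ideal.absNorm v.asIdeal : ℕ) : ℂ) ^ (-w)) s :=
    (hasDerivAt_primeTerm v s).differentiableAt
  have hlt : ‖c v * ((Ideal.absNorm v.asIdeal : ℕ) : ℂ) ^ (-s)‖ < 1 := by
    obtain ⟨b, hb0, hbs⟩ := exists_between hs
    exact (norm_primeTerm_le_two_rpow hc hb0 v hbs).trans_lt (two_rpow_neg_lt_one hb0)
  have hslit : 1 - c v * ((Ideal.absNorm v.asIdeal : ℕ) : ℂ) ^ (-s) ∈ Complex.slitPlane := by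
    rw [sub_eq_add_neg]
    exact Complex.mem_slitPlane_of_norm_lt_one (by rwa [norm_neg])
  exact ((hz.const_sub 1).clog hslit).neg.sub hz

/-- **`R` is holomorphic on `Re s > 1/2`**: on `Re s > 1/2 + δ` the terms are bounded by
`C · N v^{-(1+2δ)}`, a summable majorant (Mathlib `Complex.differentiableOn_tsum_of_summable_norm`).
[folklore] -/
theorem differentiableOn_tsum_remTerm (hc : ∀ v, ‖c v‖ ≤ 1) :
    DifferentiableOn ℂ (fun w : ℂ => ∑' v : HeightOneSpectrum (𝓞 K),
      (-Complex.log (1 - c v * ((Ideal.absNorm v.asIdeal : ℕ) : ℂ) ^ (-w)) -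
        c v * ((Ideal.absNorm v.asIdeal : ℕ) : ℂ) ^ (-w))) {s | 1 / 2 < s.re} := by
  intro s hs
  -- work on `Re w > b`, `1/2 < b < Re s`
  obtain ⟨b, hb, hbs⟩ := exists_between (show (1 : ℝ) / 2 < s.re from hs)
  have hb0 : 0 < b := by linarith
  set U : Set ℂ := {w | b < w.re} with hU
  have hUo : IsOpen U := isOpen_lt continuous_const Complex.continuous_re
  have hsU : s ∈ U := hbs
  set θ : ℝ := (2 : ℝ) ^ (-b) with hθ
  have hθ1 : θ < 1 := two_rpow_neg_lt_one hb0
  set C : ℝ := (1 - θ)⁻¹ / 2 with hC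
  have hC0 : 0 ≤ C := by
    rw [hC]; exact div_nonneg (inv_nonneg.mpr (by linarith)) (by norm_num)
  have hF : ∀ v : HeightOneSpectrum (𝓞 K), DifferentiableOn ℂ
      (fun w : ℂ => -Complex.log (1 - c v * ((Ideal.absNorm v.asIdeal : ℕ) : ℂ) ^ (-w)) -
        c v * ((Ideal.absNorm v.asIdeal : ℕ) : ℂ) ^ (-w)) U :=
    fun v w hw => (differentiableAt_remTerm hc v (hb0.trans hw)).differentiableWithinAt
  have hle : ∀ (v : HeightOneSpectrum (𝓞 K)) (w : ℂ), w ∈ U →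
      ‖-Complex.log (1 - c v * ((Ideal.absNorm v.asIdeal : ℕ) : ℂ) ^ (-w)) -
        c v * ((Ideal.absNorm v.asIdeal : ℕ) : ℂ) ^ (-w)‖ ≤
        C * ((Ideal.absNorm v.asIdeal : ℕ) : ℝ) ^ (-(2 * b)) := by
    intro v w hw
    have h1 : ‖c v * ((Ideal.absNorm v.asIdeal : ℕ) : ℂ) ^ (-w)‖ ≤ θ := norm_primeTerm_le_two_rpow hc hb0 v hw
    refine (norm_neg_log_one_sub_sub_le hθ1 h1).trans ?_
    refine mul_le_mul_of_nonneg_left ?_ hC0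
    have h2 : ‖c v * ((Ideal.absNorm v.asIdeal : ℕ) : ℂ) ^ (-w)‖ ≤ ((Ideal.absNorm v.asIdeal : ℕ) : ℝ) ^ (-b) :=
      (norm_primeTerm_le hc v w).trans (absNorm_rpow_neg_le_rpow_neg v (le_of_lt hw))
    have hpos : 0 < ((Ideal.absNorm v.asIdeal : ℕ) : ℝ) := by linarith [two_le_absNorm_real v]
    calc ‖c v * ((Ideal.absNorm v.asIdeal : ℕ) : ℂ) ^ (-w)‖ ^ 2
        ≤ (((Ideal.absNorm v.asIdeal : ℕ) : ℝ) ^ (-b)) ^ 2 := by gcongr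
      _ = ((Ideal.absNorm v.asIdeal : ℕ) : ℝ) ^ (-(2 * b)) := by
          rw [← Real.rpow_natCast, ← Real.rpow_mul hpos.le]; congr 1; push_cast; ring
  have hsum : Summable fun v : HeightOneSpectrum (𝓞 K) => C * ((Ideal.absNorm v.asIdeal : ℕ) : ℝ) ^ (-(2 * b)) :=
    (summable_absNorm_rpow_neg (by linarith)).mul_left C
  have hdiff := Complex.differentiableOn_tsum_of_summable_norm hsum hF hUo hle
  exact ((hdiff s hsU).differentiableAt (hUo.mem_nhds hsU)).differentiableWithinAt

/-- The remainder series converges absolutely for `Re s > 1/2`. [folklore] -/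
theorem summable_remTerm (hc : ∀ v, ‖c v‖ ≤ 1) {s : ℂ} (hs : 1 / 2 < s.re) :
    Summable fun v : HeightOneSpectrum (𝓞 K) =>
      (-Complex.log (1 - c v * ((Ideal.absNorm v.asIdeal : ℕ) : ℂ) ^ (-s)) -
        c v * ((Ideal.absNorm v.asIdeal : ℕ) : ℂ) ^ (-s)) := by
  obtain ⟨b, hb, hbs⟩ := exists_between (show (1 : ℝ) / 2 < s.re from hs)
  have hb0 : 0 < b := by linarith
  set θ : ℝ := (2 : ℝ) ^ (-b) with hθ
  have hθ1 : θ < 1 := two_rpow_neg_lt_one hb0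
  refine Summable.of_norm_bounded ((summable_absNorm_rpow_neg (K := K) (s := 2 * b) (by linarith)).mul_left
    ((1 - θ)⁻¹ / 2)) fun v => ?_
  have h1 : ‖c v * ((Ideal.absNorm v.asIdeal : ℕ) : ℂ) ^ (-s)‖ ≤ θ := norm_primeTerm_le_two_rpow hc hb0 v hbs
  refine (norm_neg_log_one_sub_sub_le hθ1 h1).trans ?_
  refine mul_le_mul_of_nonneg_left ?_ (div_nonneg (inv_nonneg.mpr (by linarith)) (by norm_num))
  have h2 : ‖c v * ((Ideal.absNorm v.asIdeal : ℕ) : ℂ) ^ (-s)‖ ≤ ((Ideal.absNorm v.asIdeal : ℕ) : ℝ) ^ (-b) :=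
    (norm_primeTerm_le hc v s).trans (absNorm_rpow_neg_le_rpow_neg v hbs.le)
  have hpos : 0 < ((Ideal.absNorm v.asIdeal : ℕ) : ℝ) := by linarith [two_le_absNorm_real v]
  calc ‖c v * ((Ideal.absNorm v.asIdeal : ℕ) : ℂ) ^ (-s)‖ ^ 2
      ≤ (((Ideal.absNorm v.asIdeal : ℕ) : ℝ) ^ (-b)) ^ 2 := by gcongr
    _ = ((Ideal.absNorm v.asIdeal : ℕ) : ℝ) ^ (-(2 * b)) := by
        rw [← Real.rpow_natCast, ← Real.rpow_mul hpos.le]; congr 1; push_cast; ring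

/-! ### The Euler product as an exponential -/

/-- **`∏_v (1 − z_v(s))⁻¹ = exp(P(s) + R(s))` for `Re s > 1`** (`exp(−log(1 − z)) = (1 − z)⁻¹`, Mathlib
`HasSum.cexp`). [folklore] -/
theorem hasProd_cexp_tsum (hc : ∀ v, ‖c v‖ ≤ 1) {s : ℂ} (hs : 1 < s.re) :
    HasProd (fun v : HeightOneSpectrum (𝓞 K) => (1 - c v * ((Ideal.absNorm v.asIdeal : ℕ) : ℂ) ^ (-s))⁻¹)
      (cexp ((∑' v : HeightOneSpectrum (𝓞 K), c v * ((Ideal.absNorm v.asIdeal : ℕ) : ℂ) ^ (-s)) +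
        ∑' v : HeightOneSpectrum (𝓞 K),
          (-Complex.log (1 - c v * ((Ideal.absNorm v.asIdeal : ℕ) : ℂ) ^ (-s)) -
            c v * ((Ideal.absNorm v.asIdeal : ℕ) : ℂ) ^ (-s)))) := by
  have hP := (summable_norm_primeTerm hc hs).of_norm.hasSum
  have hR := (summable_remTerm hc (by linarith : (1 : ℝ) / 2 < s.re)).hasSum
  have hE := (hP.add hR).cexp
  refine hE.congr_fun fun v => ?_
  have hlt : ‖c v * ((Ideal.absNorm v.asIdeal : ℕ) : ℂ) ^ (-s)‖ < 1 :=
    (norm_primeTerm_le_two_rpow hc one_pos v hs).trans_lt (two_rpow_neg_lt_one one_pos)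
  have hne : 1 - c v * ((Ideal.absNorm v.asIdeal : ℕ) : ℂ) ^ (-s) ≠ 0 := by
    intro h0
    have : ‖c v * ((Ideal.absNorm v.asIdeal : ℕ) : ℂ) ^ (-s)‖ = 1 := by
      rw [sub_eq_zero] at h0; rw [← h0, norm_one]
    linarith
  simp only [Function.comp_apply]
  rw [show c v * ((Ideal.absNorm v.asIdeal : ℕ) : ℂ) ^ (-s) +
      (-Complex.log (1 - c v * ((Ideal.absNorm v.asIdeal : ℕ) : ℂ) ^ (-s)) -
        c v * ((Ideal.absNorm v.asIdeal : ℕ) : ℂ) ^ (-s)) =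
      -Complex.log (1 - c v * ((Ideal.absNorm v.asIdeal : ℕ) : ℂ) ^ (-s)) by ring,
    Complex.exp_neg, Complex.exp_log hne]

/-- **An Euler product does not vanish in the half-plane of absolute convergence**: if
`∏_v (1 − c_v N v^{-s})⁻¹` converges to `L` (`Re s > 1`) then `L = exp(P(s) + R(s)) ≠ 0`
(Neukirch VII §1, proof of (1.1): "a convergent infinite product … has a non-zero value").
[cite: NeukirchANT1999, Ch. VII §8 (8.1) Proposition] -/
theorem ne_zero_of_hasProd (hc : ∀ v, ‖c v‖ ≤ 1) {s : ℂ} (hs : 1 < s.re) {L : ℂ}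
    (hL : HasProd (fun v : HeightOneSpectrum (𝓞 K) => (1 - c v * ((Ideal.absNorm v.asIdeal : ℕ) : ℂ) ^ (-s))⁻¹) L) :
    L ≠ 0 := by
  rw [hL.unique (hasProd_cexp_tsum hc hs)]
  exact Complex.exp_ne_zero _

/-! ### The logarithmic derivative: continuous extension to `Re s ≥ 1` -/

/-- **The weighted prime series minus its pole extends continuously to `Re s ≥ 1`.**  Let `‖c_v‖ ≤ 1`,
`k ∈ ℕ`, `U ⊇ {Re s ≥ 1}` open, `G` holomorphic on `U` and non-vanishing on `{Re s ≥ 1}`, and suppose that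
for `Re s > 1` the Euler product `∏_v (1 − c_v N v^{-s})⁻¹` converges to `L(s)` with `G(s) = (s − 1)^k L(s)`.
Then there is `r`, continuous on `{Re s ≥ 1}`, with
`r(s) = Σ_v c_v log(N v) N v^{-s} − k/(s − 1)` for `Re s > 1` — explicitly `r = −G'/G + R'`, since
`G = (s−1)^k exp(P + R)` gives `G'/G = k/(s−1) + P' + R'` and `P' = −D`.  (For `k = 0` read `k/(s−1) = 0`.)
This is the regularity on `Re s = 1` of `−L'/L` minus its polar part, the hypothesis of the Wiener–Ikehara
theorem in the proofs of the prime ideal theorem and of its ray-class / Chebotarev refinements.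
[cite: MontgomeryVaughan2007, §8.3 Cor. 8.8 and §8.4 Thm. 8.9 (p. 267)] -/
theorem exists_continuousOn_eq_tsum_logTerm_sub (hc : ∀ v, ‖c v‖ ≤ 1) (k : ℕ) {U : Set ℂ} (hUo : IsOpen U)
    (hU1 : {s : ℂ | 1 ≤ s.re} ⊆ U) {G L : ℂ → ℂ} (hG : DifferentiableOn ℂ G U)
    (hG0 : ∀ s : ℂ, 1 ≤ s.re → G s ≠ 0)
    (hL : ∀ s : ℂ, 1 < s.re →
      HasProd (fun v : HeightOneSpectrum (𝓞 K) => (1 - c v * ((Ideal.absNorm v.asIdeal : ℕ) : ℂ) ^ (-s))⁻¹) (L s))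
    (hGL : ∀ s : ℂ, 1 < s.re → G s = (s - 1) ^ k * L s) :
    ∃ r : ℂ → ℂ, ContinuousOn r {s : ℂ | 1 ≤ s.re} ∧
      ∀ s : ℂ, 1 < s.re → r s =
        (∑' v : HeightOneSpectrum (𝓞 K),
          c v * (Real.log ((Ideal.absNorm v.asIdeal : ℕ) : ℝ) : ℂ) * ((Ideal.absNorm v.asIdeal : ℕ) : ℂ) ^ (-s)) -
          k / (s - 1) := by
  -- notation
  set P : ℂ → ℂ := fun w => ∑' v : HeightOneSpectrum (𝓞 K), c v * ((Ideal.absNorm v.asIdeal : ℕ) : ℂ) ^ (-w)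
    with hPdef
  set R : ℂ → ℂ := fun w => ∑' v : HeightOneSpectrum (𝓞 K),
    (-Complex.log (1 - c v * ((Ideal.absNorm v.asIdeal : ℕ) : ℂ) ^ (-w)) -
      c v * ((Ideal.absNorm v.asIdeal : ℕ) : ℂ) ^ (-w)) with hRdef
  set D : ℂ → ℂ := fun w => ∑' v : HeightOneSpectrum (𝓞 K),
    c v * (Real.log ((Ideal.absNorm v.asIdeal : ℕ) : ℝ) : ℂ) * ((Ideal.absNorm v.asIdeal : ℕ) : ℂ) ^ (-w) with hDdef
  have hV : IsOpen {s : ℂ | 1 / 2 < s.re} := isOpen_lt continuous_const Complex.continuous_re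
  have hW : IsOpen {s : ℂ | 1 < s.re} := isOpen_lt continuous_const Complex.continuous_re
  have hRdiff : DifferentiableOn ℂ R {s : ℂ | 1 / 2 < s.re} := differentiableOn_tsum_remTerm hc
  -- `G = (s-1)^k exp(P + R)` on `Re s > 1`
  have hGexp : ∀ s : ℂ, 1 < s.re → G s = (s - 1) ^ k * cexp (P s + R s) := by
    intro s hs
    rw [hGL s hs, (hL s hs).unique (hasProd_cexp_tsum hc hs)]
  -- the derivative of `G` on `Re s > 1`
  have hGderiv : ∀ s : ℂ, 1 < s.re →
      deriv G s = (k : ℂ) * (s - 1) ^ (k - 1) * cexp (P s + R s) +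
        (s - 1) ^ k * (cexp (P s + R s) * (-D s + deriv R s)) := by
    intro s hs
    have hPd : HasDerivAt P (-D s) s := hasDerivAt_tsum_primeTerm hc hs
    have hRd : HasDerivAt R (deriv R s) s :=
      ((hRdiff s (by show (1:ℝ)/2 < s.re; linarith)).differentiableAt
        (hV.mem_nhds (by show (1:ℝ)/2 < s.re; linarith))).hasDerivAt
    have hpow : HasDerivAt (fun w : ℂ => (w - 1) ^ k) ((k : ℂ) * (s - 1) ^ (k - 1) * 1) s :=
      ((hasDerivAt_id s).sub_const 1).pow k
    have hexp : HasDerivAt (fun w : ℂ => cexp (P w + R w)) (cexp (P s + R s) * (-D s + deriv R s)) s :=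
      (hPd.add hRd).cexp
    have hprod := hpow.mul hexp
    have hev : G =ᶠ[𝓝 s] fun w => (w - 1) ^ k * cexp (P w + R w) := by
      filter_upwards [hW.mem_nhds hs] with w hw
      exact hGexp w hw
    have h := hprod.deriv
    simp only [mul_one] at h
    rw [hev.deriv_eq]
    exact h
  -- the candidate
  refine ⟨fun s => -(deriv G s / G s) + deriv R s, ?_, ?_⟩
  · -- continuity on `Re s ≥ 1`
    have hGc : ContinuousOn G {s : ℂ | 1 ≤ s.re} := hG.continuousOn.mono hU1
    have hG'c : ContinuousOn (deriv G) {s : ℂ | 1 ≤ s.re} :=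
      ((hG.analyticOnNhd hUo).deriv.continuousOn).mono hU1
    have hR'c : ContinuousOn (deriv R) {s : ℂ | 1 ≤ s.re} :=
      ((hRdiff.analyticOnNhd hV).deriv.continuousOn).mono fun s hs => by
        show (1 : ℝ) / 2 < s.re
        have : (1 : ℝ) ≤ s.re := hs
        linarith
    exact ((hG'c.div hGc fun s hs => hG0 s hs).neg).add hR'c
  · -- the identity on `Re s > 1`
    intro s hs
    have hs1 : s - 1 ≠ 0 := by
      intro h; rw [sub_eq_zero] at h; rw [h, Complex.one_re] at hs; exact lt_irrefl _ hs
    have hGs : G s ≠ 0 := hG0 s hs.le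
    have hE : cexp (P s + R s) ≠ 0 := Complex.exp_ne_zero _
    show -(deriv G s / G s) + deriv R s = D s - k / (s - 1)
    rw [hGderiv s hs, hGexp s hs]
    rcases Nat.eq_zero_or_pos k with hk | hk
    · subst hk
      simp only [pow_zero, Nat.cast_zero, zero_mul, zero_add, one_mul, zero_div, sub_zero]
      field_simp
      ring
    · have hk' : (s - 1) ^ k = (s - 1) * (s - 1) ^ (k - 1) := by
        rw [← pow_succ']; congr 1; omega
      rw [hk']
      field_simp
      ring

end EulerLogDeriv

end Literature.NumberTheory.LFunctions

end
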